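import Summits.QuantumFields.BalabanUV.T4Continuum.Support.NE9EndOfRecordConvention
import Summits.QuantumFields.BalabanUV.T4Continuum.Support.NE9EndOfRecordAct

/-!
# NE9EndOfRecordActConvention — T21 (`NE9EndOfRecordAct`, p232332∕p232621) AT A BOX CONVENTION: the END of record at the species data
# (`curDataConv 𝔟 ∕ kerDataConv 𝔟`), the ACTIVITIES of record on the complex tower pair chart (`actOR`, unchanged) and the doubled
# cube-chart geometry (`GoR`, unchanged), plus the cube-currency corollary with G1∕G2 discharged — so that `printConvention` (print's
# 2ᵈ-block cover, located self-correction O-ne9p1g36-1) carries checklist item (i) exactly as the single-cube frame did (cell `pub-balaban`,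
# T4-DAG §2 node U3 ∕ §6 NE9; BINDER row NE9 OWNER lineage `b2b-balaban-t4-ne9-p1`, generation 36; nothing of any import modified)

HONEST FRAMING (T4-DAG PAGE 1).  Rung (B)+1 of the FINITE-VOLUME T⁴ programme — NOT infinite volume, NOT a mass gap, NOT the
Clay problem.  NE9 (`T4OutputRate.NE9` ∧ `FadingMemory`) is a cell NEW ESTIMATE, NOT PRINTED in [I] = [Balaban1987RG1]
(CMP **109**), [II] = [Balaban1988RG2Cluster] (CMP **116**), and NOT PROVED for Bałaban's E^{(j)} («NE9 ⇐ the named binders»;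
spine PROVED 0∕9).  HONEST DEPENDENCY (cell line, verbatim): continuum YM on T⁴ ⇐ BetaPertH ∧ nine spine estimates (0/9 proved);
BetaPertH ⇐ (D1) ∧ (D4) ∧ CAP+tail; G-an2-4 gates asym, D1 and NE2/3/4.  `FlowStep.BetaPertH`, (B), (B^μ) do not occur.  Two
compositions BY NAME; every T∕(R-1)∕S row stays a displayed hypothesis (ABSOLUTE RULE); 0 sorry.

WHAT.  **`termSize_ne9_and_fadingMemory_ofConvAct`** = `NE9EndOfRecordConvention.termSize_ne9_and_fadingMemory_ofConvSpecies` at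
`G := GoR D`, `act := actOR …`, `Bg := D.carriers.BgB`, `E := TowerData (D.F.P (D.K+1)) o`; **`…_ofConvActCube`**: G1∕G2 discharged in
cube currency (`decayExtract_dbl ∕ pinBudget_dbl`, `B := a₁`).  DISGUISE TEST: compositions; not NE9 for Bałaban's E^{(j)}.

References (TYPES ∕ loci only): [Balaban1987RG1] T. Bałaban, CMP **109** (1987) 249–301, (2.13)–(2.14) p. 268, p. 270; [Balaban1988RG2Cluster]
T. Bałaban, CMP **116** (1988) 1–22, (1.23)–(1.28) pp. 7–8, (2.14)–(2.15) p. 15, (2.27)∕(2.30) p. 18, (2.40)–(2.41) p. 21.  Summits-side NEW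
work (LEAN PLACEMENT RULE); imports `NE9EndOfRecordConvention` (generation 36) and `NE9EndOfRecordAct` (p232621) BY NAME; modifies nothing.
Value = checklist item (i) at print's convention, NOT summit progress.
-/

noncomputable section

namespace Summit.QuantumFields.BalabanUV.T4Continuum.NE9EndOfRecordActConvention

open scoped BigOperators ENNReal Matrix Matrix.Norms.L2Operator
open Metric Set
open Literature.Probability.LatticeModels
open Literature.MathematicalPhysics.QuantumFieldTheory.Balaban1983to89
open Literature.MathematicalPhysics.QuantumFieldTheory.Balaban1983to89.T4OutputRate
open Literature.MathematicalPhysics.QuantumFieldTheory.Balaban1983to89.T4HistoryLipschitzRecursion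
open Literature.MathematicalPhysics.QuantumFieldTheory.Balaban1983to89.T4HistoryLipschitzOuter
open Literature.MathematicalPhysics.QuantumFieldTheory.Balaban1983to89.T4HistoryLipschitzActivity
open Literature.MathematicalPhysics.QuantumFieldTheory.Balaban1983to89.T4HistoryLipschitzActivity (ClusterGeom)
open Literature.MathematicalPhysics.QuantumFieldTheory.Balaban1983to89.T4HistoryLipschitzSegment
open Summit.QuantumFields.BalabanUV.T4Continuum.B13Carriers (TwoRuns)
open Summit.QuantumFields.BalabanUV.T4Continuum.B13DomainGeometryTR
open Summit.QuantumFields.BalabanUV.T4Continuum.NE9Lemma1Counting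
open Summit.QuantumFields.BalabanUV.T4Continuum.NE9Lemma1Gain
open Summit.QuantumFields.BalabanUV.T4Continuum.NE9Lemma1PieceClass
open Summit.QuantumFields.BalabanUV.T4Continuum.NE9Lemma1RemainderSpecies
open Summit.QuantumFields.BalabanUV.T4Continuum.NE9Lemma1CurveSpecies
open Summit.QuantumFields.BalabanUV.T4Continuum.NE9Lemma1KernelSpecies
open Summit.QuantumFields.BalabanUV.T4Continuum.NE9ComplexEncoding (doubleCarriers)
open Summit.QuantumFields.BalabanUV.T4Continuum.NE9MarginalProjection
open Summit.QuantumFields.BalabanUV.T4Continuum.NE9MarginalProjectionEnd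
open Summit.QuantumFields.BalabanUV.T4Continuum.NE9ChannelSum
open Summit.QuantumFields.BalabanUV.T4Continuum.NE9SizeFedCoupling
open Summit.QuantumFields.BalabanUV.T4Continuum.NE9TableReading
open Summit.QuantumFields.BalabanUV.T4Continuum.NE9RecursionFunctional
open Summit.QuantumFields.BalabanUV.T4Continuum.NE9EndApplied
open Summit.QuantumFields.BalabanUV.T4Continuum.NE9ChartFamilyPullback
open Summit.QuantumFields.BalabanUV.T4Continuum.NE9EndAppliedRealRow
open Summit.QuantumFields.BalabanUV.T4Continuum.NE9SpeciesFrameOfRecord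
open Summit.QuantumFields.BalabanUV.T4Continuum.NE9SpeciesDataOfRecord
open Summit.QuantumFields.BalabanUV.T4Continuum.NE9SpeciesDataOfRecordAdmissible

open Summit.QuantumFields.BalabanUV.T4Continuum.NE9EndOfRecordSpecies
open Summit.QuantumFields.BalabanUV.T4Continuum.NE9SpeciesFrameConvention
open Summit.QuantumFields.BalabanUV.T4Continuum.NE9SpeciesDataConvention
open Summit.QuantumFields.BalabanUV.T4Continuum.NE9EndOfRecordConvention
open Summit.QuantumFields.BalabanUV.T4Continuum.NE9EndOfRecordAct (GoR actOR)
open Summit.QuantumFields.BalabanUV.T4Continuum.NE9DoubledChart (dblChart)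
open Summit.QuantumFields.BalabanUV.T4Continuum.B13CarriersCubeChart (cubeChart)
open Summit.QuantumFields.BalabanUV.T4Continuum.B13HistDatum
open Summit.QuantumFields.BalabanUV.T4Continuum.B13HistMeasurable
open Summit.QuantumFields.BalabanUV.T4Continuum.B13StepTermLabels (InnerLabel)
open Summit.QuantumFields.BalabanUV.T4Continuum.B13InnerData (Bnd)
open Summit.QuantumFields.BalabanUV.T4Continuum.CovariantBlockAveraging (ContourSystem)
open Literature.MathematicalPhysics.QuantumFieldTheory.Balaban1983to89.B5Prop11Plancherel (Tor)
open Literature.MathematicalPhysics.QuantumFieldTheory.Balaban1983to89.B5G183RateUnitTower (lev)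
open Literature.MathematicalPhysics.QuantumFieldTheory.Balaban1983to89.T4HistoryLipschitzCubeGeometry (CubeChart)
open Summit.QuantumFields.BalabanUV.T4Continuum.SubstrateBackgroundTransporters (unitMod)
open Summit.QuantumFields.BalabanUV.T4Continuum.SubstrateTwoRunsDriven (DrivenRuns)
open Summit.QuantumFields.BalabanUV.T4Continuum.SubstrateTransporterSpecies (TowerData towerDataOf)
open Summit.QuantumFields.BalabanUV.T4Continuum.SubstrateSlotsOfRecord (SlotLetters slotsOfRecord)
open Summit.QuantumFields.BalabanUV.T4Continuum.NE9ChartFaceOperator (actChart rawTKernel towerPairChart)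
open Summit.QuantumFields.BalabanUV.T4Continuum.NE9ChartFaceTable (iRecC)

variable {G₀ : Type} [GaugeGroup G₀] (D : DrivenRuns G₀) (𝔟 : BoxConvention D.toTwoRuns)

/-! ## §1 The letters of the activities of record (as in `NE9EndOfRecordAct`) -/

variable {o : Type} [Fintype o] [DecidableEq o] (ιR : G₀ →* Matrix o o ℂ) (cR : ℂ) (aR : ℝ) (sR : ℕ → ℂ)
variable {T ι' S Ω 𝒴 : Type} (P : MeasPotFrame D.carriers) {IOp : Type*}
  (𝒵 : D.carriers.Dom → InnerLabel D.carriers.Dom (Bnd D.toTwoRuns) → Type) [∀ Z j, Fintype (𝒵 Z j)]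
  (dom : ∀ Z j, 𝒵 Z j → D.carriers.Dom)
  (Jc : D.carriers.Dom → InnerLabel D.carriers.Dom (Bnd D.toTwoRuns) → Type) [∀ Z j, Fintype (Jc Z j)]
  (VR : D.carriers.Dom → InnerLabel D.carriers.Dom (Bnd D.toTwoRuns) → Type) [∀ Z j, NormedAddCommGroup (VR Z j)]
  [∀ Z j, InnerProductSpace ℝ (VR Z j)] [∀ Z j, MeasurableSpace (VR Z j)] [∀ Z j, BorelSpace (VR Z j)] [∀ Z j, FiniteDimensional ℝ (VR Z j)]
  (mI : D.carriers.Dom → InnerLabel D.carriers.Dom (Bnd D.toTwoRuns) → Type) [∀ Z j, Fintype (mI Z j)] [∀ Z j, DecidableEq (mI Z j)]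
  (L : SlotLetters D (o := o) (T := T) (ι' := ι') (S := S) (Ω := Ω) (𝒴 := 𝒴) P (IOp := IOp) 𝒵 dom Jc VR mI)
  (dk : TowerData (D.F.P (D.K + 1)) o → TowerData (D.F.P (D.K + 1)) o → ℕ → T → ι' → ι' → ℂ)
  (gc : TowerData (D.F.P (D.K + 1)) o → TowerData (D.F.P (D.K + 1)) o → ℕ → T →
    ((Tor (unitMod (D.F.P (D.K + 1))) × Fin (D.F.P (D.K + 1)).d) × o) → ι' → ℂ)
  (pQ : ℝ → TowerData (D.F.P (D.K + 1)) o → TowerData (D.F.P (D.K + 1)) o → ℕ → Ω → 𝒴 →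
    ((Tor (unitMod (D.F.P (D.K + 1))) × Fin (D.F.P (D.K + 1)).d) × o) → ((Tor (unitMod (D.F.P (D.K + 1))) × Fin (D.F.P (D.K + 1)).d) × o) → ℂ)
  (pR : ℝ → TowerData (D.F.P (D.K + 1)) o → TowerData (D.F.P (D.K + 1)) o → ℕ → Ω → 𝒴 → ℂ)
  (ρ : ℝ) {ι τ : Type} [Fintype τ] (cc : ℕ → TowerData (D.F.P (D.K + 1)) o → PotIdx P.toPotFrame → τ → ι) (wR : τ → ℂ)

/-! ## §2 The END of record at the species data, the activities and the geometry of record -/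

/-- **THE END OF RECORD AT THE SPECIES DATA AND THE ACTIVITIES OF RECORD** (`NE9EndOfRecordSpecies.termSize_ne9_and_fadingMemory_ofRecordSpecies`
with `G := GoR D`, `act U := actOR … U`, `Bg := D.carriers.BgB`, `E := TowerData (D.F.P (D.K+1)) o`): every hypothesis is T20's verbatim
at these objects; conclusion LITERALLY the END's `TermSize ∧ NE9 ∧ FadingMemory`. [cite: Balaban1987RG1, Thm 1 p.259, (1.18) p.263, (2.13)-(2.14) p.268; Balaban1988RG2Cluster, (1.23)-(1.29) pp.7-8, (1.33)-(1.36) p.9, (2.14)-(2.15) p.15] -/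
theorem termSize_ne9_and_fadingMemory_ofConvAct {Pt : Type} [Nonempty ι] (U₁ : D.carriers.BgB)
    (pt : D.carriers.BgB → TowerData (D.F.P (D.K + 1)) o) (𝔭 : SpeciesParams D.toTwoRuns D.carriers.BgB (TowerData (D.F.P (D.K + 1)) o) ι Pt)
    {ℓg gain : ℕ → ℕ → ℝ} (ℓk : ℕ → ℕ → ℝ) {cdir cK δ₀ δ₁ w w0 c0 c1 cQa cQb : ℝ} {W : Set (ℕ → ℝ)}
    {Adm MF : D.carriers.BgB → Set (TowerData (D.F.P (D.K + 1)) o → (doubleCarriers D.carriers).Dom → ℝ)}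
    {r : D.carriers.BgB → ℕ → (TowerData (D.F.P (D.K + 1)) o → (doubleCarriers D.carriers).Dom → ℝ) → ℝ}
    {A : D.carriers.BgB → TowerData (D.F.P (D.K + 1)) o → (doubleCarriers D.carriers).Dom → ℝ}
    {n : D.carriers.BgB → ℕ → ℝ → TowerData (D.F.P (D.K + 1)) o → Finset (SCube D.toTwoRuns) → ℝ} {lip clip : ℕ → ℝ} {a d : Finset (SCube D.toTwoRuns) → ℝ} {δv : (doubleCarriers D.carriers).Dom → ℝ}
    {κ B lipbar clipbar qTbar ω cr aA Nbar clipa lam : ℝ} {p₀ N : ℕ → ℝ}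
    -- species (a): the analytic clauses of `CurData.Admissible` at the data of record, and the letters
    (hκ₁1 : 1 ≤ 𝔭.κ₁) (hrT : ∀ k, 0 < 𝔭.rT k) (hRad : ∀ X, 0 < 𝔭.Rad X)
    (hcur : ∀ (U : D.carriers.BgB) (k : ℕ) (s : ℕ → ℝ) (y : ι) (a : SCube D.toTwoRuns) (b : Finset (SCube D.toTwoRuns)) (x : (doubleCarriers D.carriers).Dom),
      ∀ t ∈ sphere (0:ℂ) (𝔭.rT k), ∀ (s' : SCube D.toTwoRuns → ℝ) (σ' : SCube D.toTwoRuns → ℂ), OnContour 𝔭.κ₁ (cubesListC D.toTwoRuns 𝔟 k a b) s' σ' →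
        DifferentiableOn ℂ (𝔭.cur U k s y a b x t s' σ') (ball 0 (𝔭.ϱ U k s y a b x)) ∧
          MapsTo (𝔭.cur U k s y a b x t s' σ') (ball 0 (𝔭.ϱ U k s y a b x)) (ball 0 (𝔭.Rad x.1)))
    (hϱgt : ∀ U k s y a b x, 1 < 𝔭.ϱ U k s y a b x)
    (hϱinv : ∀ (U : D.carriers.BgB) (k : ℕ) (s : ℕ → ℝ) (y : ι), ∀ a ∈ boxes D.toTwoRuns k (𝔭.Yout k y), ∀ b ∈ famC D.toTwoRuns 𝔟 k (𝔭.Yout k y) a,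
      ∀ (j : ℕ), ∀ x ∈ srcC D.toTwoRuns 𝔟 k a j, (𝔭.ϱ U k s y a b x)⁻¹ ≤ cdir * ℓg k j)
    (hℓ : ∀ k j, 0 < ℓg k j) (hκ : 144 ≤ κ) (hκ₁ : 69 ≤ 𝔭.κ₁) (hnA : (𝔟.nA : ℝ) ≤ (10 : ℝ) ^ 12)
    (hLaℓ : ∀ k j, j ≤ k → (𝔟.nW : ℝ) * ((D.F.L : ℝ) ^ 4) ^ (k - j) * ℓg k j ^ 5 ≤ cQa * agePow ω k j)
    (hAa : ∀ U, PieceAdditiveOn (analyticClass (𝔭.DC 𝔟 U).R) (𝔭.DC 𝔟 U).toC)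
    (hclipa : 0 ≤ clipa) (hcdir : 0 < cdir) (hhalf : ∀ k j, cdir * ℓg k j < 1 / 2)
    (hcont : ∀ U, ∀ (k : ℕ) (s : ℕ → ℝ) (y : ι) (a : SCube D.toTwoRuns) (b : Finset (SCube D.toTwoRuns)) (x : (doubleCarriers D.carriers).Dom),
      ContinuousOn (fun q : (ℂ × ((SCube D.toTwoRuns → ℝ) × (SCube D.toTwoRuns → ℂ))) × ℂ => (𝔭.DC 𝔟 U).cur k s y a b x q.1.1 q.1.2.1 q.1.2.2 q.2)
        ((sphere (0:ℂ) ((𝔭.DC 𝔟 U).r k) ×ˢ {q | OnContour (𝔭.DC 𝔟 U).κ₁ ((𝔭.DC 𝔟 U).cubes k y a b) q.1 q.2}) ×ˢ sphere (0:ℂ) 1))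
    (hlip : ∀ U, ∀ g ∈ W, ∀ g' ∈ W, ∀ (k : ℕ) (y : ι), ∀ a ∈ (𝔭.DC 𝔟 U).S0 k y, ∀ b ∈ (𝔭.DC 𝔟 U).SY k y a, ∀ (j : ℕ),
      ∀ x ∈ (𝔭.DC 𝔟 U).src k y a j, ∀ t ∈ sphere (0:ℂ) ((𝔭.DC 𝔟 U).r k), ∀ (s' : SCube D.toTwoRuns → ℝ) (σ' : SCube D.toTwoRuns → ℂ),
        OnContour (𝔭.DC 𝔟 U).κ₁ ((𝔭.DC 𝔟 U).cubes k y a b) s' σ' → ∀ τ ∈ ball (0:ℂ) (1 / (2 * (cdir * ℓg k j))),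
          ‖(𝔭.DC 𝔟 U).cur k g y a b x t s' σ' τ - (𝔭.DC 𝔟 U).cur k g' y a b x t s' σ' τ‖ ≤ clipa * ((𝔭.DC 𝔟 U).R x.1 / 2) * |g k - g' k|)
    (hroom : ∀ U, ∀ g ∈ W, ∀ (k : ℕ) (y : ι), ∀ a ∈ (𝔭.DC 𝔟 U).S0 k y, ∀ b ∈ (𝔭.DC 𝔟 U).SY k y a, ∀ (j : ℕ), ∀ x ∈ (𝔭.DC 𝔟 U).src k y a j,
      ∀ t ∈ sphere (0:ℂ) ((𝔭.DC 𝔟 U).r k), ∀ (s' : SCube D.toTwoRuns → ℝ) (σ' : SCube D.toTwoRuns → ℂ), OnContour (𝔭.DC 𝔟 U).κ₁ ((𝔭.DC 𝔟 U).cubes k y a b) s' σ' →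
        ∀ τ ∈ ball (0:ℂ) (1 / (2 * (cdir * ℓg k j))), ‖(𝔭.DC 𝔟 U).cur k g y a b x t s' σ' τ‖ ≤ (𝔭.DC 𝔟 U).R x.1 / 2)
    -- species (b): the analytic ∕ geometric clauses of `KerData.Admissible` at the data of record, and the letters
    (hzero : ∀ U k s y a b x t s' σ' p q, 𝔭.ker U k s y a b x t s' σ' p q (0 : TowerData (D.F.P (D.K + 1)) o → ℂ) = 0)
    (hkerB : ∀ (U : D.carriers.BgB) (k : ℕ) (s : ℕ → ℝ) (y : ι), ∀ a ∈ boxes D.toTwoRuns k (𝔭.Yout k y), ∀ b ∈ famC D.toTwoRuns 𝔟 k (𝔭.Yout k y) a, ∀ (j : ℕ),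
      ∀ x ∈ srcC D.toTwoRuns 𝔟 k a j, ∀ t ∈ sphere (0:ℂ) (𝔭.rT k), ∀ (s' : SCube D.toTwoRuns → ℝ) (σ' : SCube D.toTwoRuns → ℂ),
        OnContour 𝔭.κ₁ (cubesListC D.toTwoRuns 𝔟 k a b) s' σ' → ∀ p ∈ 𝔭.pts k y a, ∀ q ∈ 𝔭.pts k y a, ∀ (F : TowerData (D.F.P (D.K + 1)) o → ℂ) (M : ℝ),
          DifferentiableOn ℂ F (ball 0 (𝔭.Rad x.1)) → (∀ z ∈ ball (0 : TowerData (D.F.P (D.K + 1)) o) (𝔭.Rad x.1), ‖F z‖ ≤ M) →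
            ‖𝔭.ker U k s y a b x t s' σ' p q F‖ ≤
              cK * M * gain k j * 𝔭.ρd p q ^ 𝔭.m * Real.exp (-(δ₀ * (𝔭.dX x.1 p + 𝔭.dX x.1 q))))
    (hgeom : ∀ (k : ℕ) (y : ι) (a : SCube D.toTwoRuns) (x : (doubleCarriers D.carriers).Dom), ∀ p ∈ 𝔭.pts k y a, ∀ q ∈ 𝔭.pts k y a,
      δ₁ * 𝔭.ρd (𝔭.p0 x.1) p + δ₁ * 𝔭.ρd p q ≤ δ₀ * (𝔭.dX x.1 p + 𝔭.dX x.1 q) + w * D.carriers.d x.1 + w0)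
    (hsum0 : ∀ (k : ℕ) (y : ι) (a : SCube D.toTwoRuns) (X : D.carriers.Dom), ∑ p ∈ 𝔭.pts k y a, Real.exp (-(δ₁ * 𝔭.ρd (𝔭.p0 X) p)) ≤ c0)
    (hsum1 : ∀ (k : ℕ) (y : ι) (a : SCube D.toTwoRuns), ∀ p ∈ 𝔭.pts k y a,
      ∑ q ∈ 𝔭.pts k y a, 𝔭.ρd p q ^ 𝔭.m * Real.exp (-(δ₁ * 𝔭.ρd p q)) ≤ c1)
    (hcK : 0 ≤ cK) (hgain : ∀ k j, 0 ≤ gain k j) (hρd : ∀ p q, 0 ≤ 𝔭.ρd p q) (hc0 : 0 ≤ c0) (hc1 : 0 ≤ c1)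
    (hκw : 144 ≤ κ - w) (hLbℓ : ∀ k j, j ≤ k → (𝔟.nW : ℝ) * ((D.F.L : ℝ) ^ 4) ^ (k - j) * gain k j ≤ cQb * agePow ω k j)
    (hAb : ∀ U, PieceAdditiveOn (analyticClass (𝔭.KC 𝔟 U).R) (𝔭.KC 𝔟 U).toC) (hlam : 0 ≤ lam)
    (hkerC : ∀ U, ∀ (k : ℕ) (s : ℕ → ℝ) (y : ι) (a : SCube D.toTwoRuns) (b : Finset (SCube D.toTwoRuns)) (x : (doubleCarriers D.carriers).Dom),
      ∀ p ∈ (𝔭.KC 𝔟 U).pts k y a, ∀ q ∈ (𝔭.KC 𝔟 U).pts k y a, ∀ F : TowerData (D.F.P (D.K + 1)) o → ℂ, DifferentiableOn ℂ F (ball 0 ((𝔭.KC 𝔟 U).R x.1)) →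
        Continuous fun wv : ℂ × (SCube D.toTwoRuns → ℝ) × (SCube D.toTwoRuns → ℂ) => (𝔭.KC 𝔟 U).ker k s y a b x wv.1 wv.2.1 wv.2.2 p q F)
    (hkerL : ∀ U, ∀ g ∈ W, ∀ g' ∈ W, ∀ (k : ℕ) (y : ι), ∀ a ∈ (𝔭.KC 𝔟 U).S0 k y, ∀ b ∈ (𝔭.KC 𝔟 U).SY k y a, ∀ (j : ℕ),
      ∀ x ∈ (𝔭.KC 𝔟 U).src k y a j, ∀ t ∈ sphere (0:ℂ) ((𝔭.KC 𝔟 U).r k), ∀ (s' : SCube D.toTwoRuns → ℝ) (σ' : SCube D.toTwoRuns → ℂ),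
        OnContour (𝔭.KC 𝔟 U).κ₁ ((𝔭.KC 𝔟 U).cubes k y a b) s' σ' → ∀ p ∈ (𝔭.KC 𝔟 U).pts k y a, ∀ q ∈ (𝔭.KC 𝔟 U).pts k y a,
          ∀ (F : TowerData (D.F.P (D.K + 1)) o → ℂ) (M : ℝ), DifferentiableOn ℂ F (ball 0 ((𝔭.KC 𝔟 U).R x.1)) → (∀ z ∈ ball (0 : TowerData (D.F.P (D.K + 1)) o) ((𝔭.KC 𝔟 U).R x.1), ‖F z‖ ≤ M) →
            ‖(𝔭.KC 𝔟 U).ker k g y a b x t s' σ' p q F - (𝔭.KC 𝔟 U).ker k g' y a b x t s' σ' p q F‖ ≤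
              cK * lam * M * gain k j * (𝔭.KC 𝔟 U).ρd p q ^ (𝔭.KC 𝔟 U).m * Real.exp (-(δ₀ * ((𝔭.KC 𝔟 U).dX x.1 p + (𝔭.KC 𝔟 U).dX x.1 q))) *
                |g k - g' k|)
    (hcQa : 0 ≤ cQa) (hcQb : 0 ≤ cQb) (hMF : ∀ U, MF U ⊆ analyticClass (𝔭.DC 𝔟 U).R)
    -- the recursion data, per chart
    (U₀ : D.carriers.BgB → TowerData (D.F.P (D.K + 1)) o)
    (explZ : D.carriers.BgB → ℕ → TowerData (D.F.P (D.K + 1)) o → (doubleCarriers D.carriers).Dom → ℝ)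
    (base : D.carriers.BgB → TowerData (D.F.P (D.K + 1)) o → (doubleCarriers D.carriers).Dom → ℝ)
    (hAdm : ∀ U, AdmissibleTerms (EfOf (GoR D) (actOR D ιR cR aR sR P 𝒵 dom Jc VR mI L dk gc pQ pR ρ cc wR U) (weightOf (𝔭.DC 𝔟 U).toC.frame (𝔭.DC 𝔟 U).κ₁ (1 + 𝔟.nA + 𝔟.nB) (2 * (2 ^ 20 + 1)) ((𝔭.DC 𝔟 U).Kp cdir + (𝔭.KC 𝔟 U).Kp cK w0 c0 c1))
      (U₀ U) (explZ U) (base U) (cpieceChannel (𝔭.DC 𝔟 U).toC + cpieceChannel (𝔭.KC 𝔟 U).toC) (margProj (r U) (A U))) W (Adm U))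
    (hres : ∀ U, AdmRestrict (Adm U))
    (hrA : ∀ U, ReadAdditive (Adm U) (r U)) (hr0 : ∀ U, ReadZero (r U)) (hrs : ∀ U, ReadSize (Adm U) (r U) κ cr)
    (hA : ∀ U, DirSize (A U) κ aA) (hcr : 0 ≤ cr) (haA : 0 ≤ aA) (hPinto : ∀ U, ProjInto (Adm U) (MF U) (margProj (r U) (A U)))
    (hclip0 : ∀ k, 0 ≤ clip k)
    (hCup : ∀ U, ∀ g ∈ W, ∀ g' ∈ W, ∀ (k : ℕ) (Vc : TowerData (D.F.P (D.K + 1)) o) (X : (doubleCarriers D.carriers).Dom), (doubleCarriers D.carriers).scale X = k + 1 →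
      ∀ Q ∈ admOf (GoR D) (actOR D ιR cR aR sR P 𝒵 dom Jc VR mI L dk gc pQ pR ρ cc wR U) (weightOf (𝔭.DC 𝔟 U).toC.frame (𝔭.DC 𝔟 U).κ₁ (1 + 𝔟.nA + 𝔟.nB) (2 * (2 ^ 20 + 1)) ((𝔭.DC 𝔟 U).Kp cdir + (𝔭.KC 𝔟 U).Kp cK w0 c0 c1)) (U₀ U) (explZ U)
        (base U) (cpieceChannel (𝔭.DC 𝔟 U).toC + cpieceChannel (𝔭.KC 𝔟 U).toC) (margProj (r U) (A U)) W
        (fun k => sizeRadius (fun k j => (1 + cr * aA) * (tauOfG cQa (agePow ω) + tauOfG cQb (agePow ω)) k j) N k) k,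
      ∀ γ' ∈ (GoR D).vol X,
        ‖actOR D ιR cR aR sR P 𝒵 dom Jc VR mI L dk gc pQ pR ρ cc wR U k (g k) Vc Q γ'‖ ≤ n U k (g' k) Vc γ' ∧
          ‖actOR D ιR cR aR sR P 𝒵 dom Jc VR mI L dk gc pQ pR ρ cc wR U k (g k) Vc Q γ' -
              actOR D ιR cR aR sR P 𝒵 dom Jc VR mI L dk gc pQ pR ρ cc wR U k (g' k) Vc Q γ'‖ ≤ clip k * |g k - g' k| * n U k (g' k) Vc γ')
    (hclipb : ∀ k, clip k ≤ clipbar) (hNb : ∀ j, N j ≤ Nbar)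
    (hqTb : (64 * clipa * cQa + lam * cQb) * ((1 + cr * aA) * Nbar) * (1 - ω)⁻¹ ≤ qTbar)
    (hKP : ∀ U, TwoPointKP (GoR D) W (actOR D ιR cR aR sR P 𝒵 dom Jc VR mI L dk gc pQ pR ρ cc wR U) (admOf (GoR D) (actOR D ιR cR aR sR P 𝒵 dom Jc VR mI L dk gc pQ pR ρ cc wR U) (weightOf (𝔭.DC 𝔟 U).toC.frame (𝔭.DC 𝔟 U).κ₁ (1 + 𝔟.nA + 𝔟.nB) (2 * (2 ^ 20 + 1)) ((𝔭.DC 𝔟 U).Kp cdir + (𝔭.KC 𝔟 U).Kp cK w0 c0 c1))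
      (U₀ U) (explZ U) (base U) (cpieceChannel (𝔭.DC 𝔟 U).toC + cpieceChannel (𝔭.KC 𝔟 U).toC) (margProj (r U) (A U)) W
      (fun k => sizeRadius (fun k j => (1 + cr * aA) * (tauOfG cQa (agePow ω) + tauOfG cQb (agePow ω)) k j) N k)) (n U) lip a d)
    (hdec : (GoR D).DecayExtract δv d) (hpin : (GoR D).PinBudget a δv (fun _ => B) κ)
    (hexplZ : ∀ U, ∀ (k : ℕ) (Vc : TowerData (D.F.P (D.K + 1)) o) (X : (doubleCarriers D.carriers).Dom), (doubleCarriers D.carriers).scale X = k + 1 →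
      |explZ U k Vc X| ≤ Real.exp (-(κ * (doubleCarriers D.carriers).d X)) * p₀ k)
    (hbase0 : ∀ U, ∀ (Vc : TowerData (D.F.P (D.K + 1)) o) (X : (doubleCarriers D.carriers).Dom), (doubleCarriers D.carriers).scale X = 0 →
      |base U Vc X| ≤ Real.exp (-(κ * (doubleCarriers D.carriers).d X)) * N 0)
    (hNsucc : ∀ j, p₀ j + 2 * B ≤ N (j + 1)) (hNnn : ∀ j, 0 ≤ N j)
    (hB : 0 ≤ B) (hlipb : ∀ k, lip k ≤ lipbar) (hω : 0 ≤ ω) (hω1 : ω < 1)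
    (hpos : 0 < ω + 8 * lipbar * B * ((1 + cr * aA) * (cQa + cQb))) :
    TermSize (EreOf (GoR D) (actOR D ιR cR aR sR P 𝒵 dom Jc VR mI L dk gc pQ pR ρ cc wR) (fun U => weightOf (𝔭.DC 𝔟 U).toC.frame (𝔭.DC 𝔟 U).κ₁ (1 + 𝔟.nA + 𝔟.nB) (2 * (2 ^ 20 + 1)) ((𝔭.DC 𝔟 U).Kp cdir + (𝔭.KC 𝔟 U).Kp cK w0 c0 c1)) U₀ explZ base
        (fun U => cpieceChannel (𝔭.DC 𝔟 U).toC + cpieceChannel (𝔭.KC 𝔟 U).toC) (fun U => margProj (r U) (A U)) pt) W κ N ∧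
      NE9 (EreOf (GoR D) (actOR D ιR cR aR sR P 𝒵 dom Jc VR mI L dk gc pQ pR ρ cc wR) (fun U => weightOf (𝔭.DC 𝔟 U).toC.frame (𝔭.DC 𝔟 U).κ₁ (1 + 𝔟.nA + 𝔟.nB) (2 * (2 ^ 20 + 1)) ((𝔭.DC 𝔟 U).Kp cdir + (𝔭.KC 𝔟 U).Kp cK w0 c0 c1)) U₀ explZ base
        (fun U => cpieceChannel (𝔭.DC 𝔟 U).toC + cpieceChannel (𝔭.KC 𝔟 U).toC) (fun U => margProj (r U) (A U)) pt) W κ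
        (prodModuli (8 * clipbar * B + 8 * lipbar * B * qTbar) fun _ => ω + 8 * lipbar * B * ((1 + cr * aA) * (cQa + cQb))) ∧
        FadingMemory ((8 * clipbar * B + 8 * lipbar * B * qTbar) / (ω + 8 * lipbar * B * ((1 + cr * aA) * (cQa + cQb))))
          (ω + 8 * lipbar * B * ((1 + cr * aA) * (cQa + cQb)))
          (prodModuli (8 * clipbar * B + 8 * lipbar * B * qTbar)
            fun _ => ω + 8 * lipbar * B * ((1 + cr * aA) * (cQa + cQb))) :=
  termSize_ne9_and_fadingMemory_ofConvSpecies 𝔟 (GoR D) U₁ pt 𝔭 ℓk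
    (act := actOR D ιR cR aR sR P 𝒵 dom Jc VR mI L dk gc pQ pR ρ cc wR)
    hκ₁1 hrT hRad hcur hϱgt hϱinv hℓ hκ hκ₁ hnA hLaℓ hAa hclipa hcdir hhalf hcont hlip hroom hzero hkerB hgeom hsum0 hsum1 hcK hgain hρd
    hc0 hc1 hκw hLbℓ hAb hlam hkerC hkerL hcQa hcQb hMF U₀ explZ base hAdm hres hrA hr0 hrs hA hcr haA hPinto hclip0 hCup hclipb
    hNb hqTb hKP hdec hpin hexplZ hbase0 hNsucc hNnn hB hlipb hω hω1 hpos

/-! ## §3 The geometry leaves discharged in cube currency -/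

open Summit.QuantumFields.BalabanUV.T4Continuum.NE9DoubledChart (decayExtract_dbl pinBudget_dbl)

/-- **THE END OF RECORD AT THE SPECIES DATA, THE ACTIVITIES AND THE GEOMETRY OF RECORD, G1∕G2 DISCHARGED (cube currency)**:
`termSize_ne9_and_fadingMemory_ofRecordAct` with the Kotecký–Preiss weights READ AS the cube chart's size weights `a := sizeWeight a₁`,
`d := sizeWeight d₁`, the extracted decay `δ X := d₁·#cubes X` and the CONSTANT pin envelope `B := a₁` — `hdec ∕ hpin` supplied by
`NE9DoubledChart.decayExtract_dbl ∕ pinBudget_dbl` (= `CubeChart.decayExtract ∕ pinBudget` at `dblChart (cubeChart …)`) from `0 ≤ a₁`,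
`κ ≤ d₁` (and `0 ≤ κ` from `144 ≤ κ`); the letter `B` of the END becomes `a₁` in `ℓ = 8·clipbar·a₁ + 8·lipbar·a₁·qTbar` and
`ω′ = ω + 8·lipbar·a₁·(1+cr·aA)·(cQa+cQb)`.  CUBE-CURRENCY RIDER (F-ne9leaf01-1, `NE9CubeCurrencyBudget`): producers of `hKP` in this
currency pay the rate division and the fading factor recorded there; the d-currency producers (crew row (w13)) avoid them — this
corollary only removes the two geometry binders. [cite: Balaban1988RG2Cluster, (2.27) p.18, (2.30) p.18, (2.40)-(2.41) p.21] -/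
theorem termSize_ne9_and_fadingMemory_ofConvActCube {Pt : Type} [Nonempty ι] (U₁ : D.carriers.BgB)
    (pt : D.carriers.BgB → TowerData (D.F.P (D.K + 1)) o) (𝔭 : SpeciesParams D.toTwoRuns D.carriers.BgB (TowerData (D.F.P (D.K + 1)) o) ι Pt)
    {ℓg gain : ℕ → ℕ → ℝ} (ℓk : ℕ → ℕ → ℝ) {cdir cK δ₀ δ₁ w w0 c0 c1 cQa cQb : ℝ} {W : Set (ℕ → ℝ)}
    {Adm MF : D.carriers.BgB → Set (TowerData (D.F.P (D.K + 1)) o → (doubleCarriers D.carriers).Dom → ℝ)}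
    {r : D.carriers.BgB → ℕ → (TowerData (D.F.P (D.K + 1)) o → (doubleCarriers D.carriers).Dom → ℝ) → ℝ}
    {A : D.carriers.BgB → TowerData (D.F.P (D.K + 1)) o → (doubleCarriers D.carriers).Dom → ℝ}
    {n : D.carriers.BgB → ℕ → ℝ → TowerData (D.F.P (D.K + 1)) o → Finset (SCube D.toTwoRuns) → ℝ} {lip clip : ℕ → ℝ} {a₁ d₁ : ℝ}
    {κ lipbar clipbar qTbar ω cr aA Nbar clipa lam : ℝ} {p₀ N : ℕ → ℝ} (ha₁ : 0 ≤ a₁) (hκd : κ ≤ d₁)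
    -- species (a): the analytic clauses of `CurData.Admissible` at the data of record, and the letters
    (hκ₁1 : 1 ≤ 𝔭.κ₁) (hrT : ∀ k, 0 < 𝔭.rT k) (hRad : ∀ X, 0 < 𝔭.Rad X)
    (hcur : ∀ (U : D.carriers.BgB) (k : ℕ) (s : ℕ → ℝ) (y : ι) (a : SCube D.toTwoRuns) (b : Finset (SCube D.toTwoRuns)) (x : (doubleCarriers D.carriers).Dom),
      ∀ t ∈ sphere (0:ℂ) (𝔭.rT k), ∀ (s' : SCube D.toTwoRuns → ℝ) (σ' : SCube D.toTwoRuns → ℂ), OnContour 𝔭.κ₁ (cubesListC D.toTwoRuns 𝔟 k a b) s' σ' →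
        DifferentiableOn ℂ (𝔭.cur U k s y a b x t s' σ') (ball 0 (𝔭.ϱ U k s y a b x)) ∧
          MapsTo (𝔭.cur U k s y a b x t s' σ') (ball 0 (𝔭.ϱ U k s y a b x)) (ball 0 (𝔭.Rad x.1)))
    (hϱgt : ∀ U k s y a b x, 1 < 𝔭.ϱ U k s y a b x)
    (hϱinv : ∀ (U : D.carriers.BgB) (k : ℕ) (s : ℕ → ℝ) (y : ι), ∀ a ∈ boxes D.toTwoRuns k (𝔭.Yout k y), ∀ b ∈ famC D.toTwoRuns 𝔟 k (𝔭.Yout k y) a,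
      ∀ (j : ℕ), ∀ x ∈ srcC D.toTwoRuns 𝔟 k a j, (𝔭.ϱ U k s y a b x)⁻¹ ≤ cdir * ℓg k j)
    (hℓ : ∀ k j, 0 < ℓg k j) (hκ : 144 ≤ κ) (hκ₁ : 69 ≤ 𝔭.κ₁) (hnA : (𝔟.nA : ℝ) ≤ (10 : ℝ) ^ 12)
    (hLaℓ : ∀ k j, j ≤ k → (𝔟.nW : ℝ) * ((D.F.L : ℝ) ^ 4) ^ (k - j) * ℓg k j ^ 5 ≤ cQa * agePow ω k j)
    (hAa : ∀ U, PieceAdditiveOn (analyticClass (𝔭.DC 𝔟 U).R) (𝔭.DC 𝔟 U).toC)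
    (hclipa : 0 ≤ clipa) (hcdir : 0 < cdir) (hhalf : ∀ k j, cdir * ℓg k j < 1 / 2)
    (hcont : ∀ U, ∀ (k : ℕ) (s : ℕ → ℝ) (y : ι) (a : SCube D.toTwoRuns) (b : Finset (SCube D.toTwoRuns)) (x : (doubleCarriers D.carriers).Dom),
      ContinuousOn (fun q : (ℂ × ((SCube D.toTwoRuns → ℝ) × (SCube D.toTwoRuns → ℂ))) × ℂ => (𝔭.DC 𝔟 U).cur k s y a b x q.1.1 q.1.2.1 q.1.2.2 q.2)
        ((sphere (0:ℂ) ((𝔭.DC 𝔟 U).r k) ×ˢ {q | OnContour (𝔭.DC 𝔟 U).κ₁ ((𝔭.DC 𝔟 U).cubes k y a b) q.1 q.2}) ×ˢ sphere (0:ℂ) 1))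
    (hlip : ∀ U, ∀ g ∈ W, ∀ g' ∈ W, ∀ (k : ℕ) (y : ι), ∀ a ∈ (𝔭.DC 𝔟 U).S0 k y, ∀ b ∈ (𝔭.DC 𝔟 U).SY k y a, ∀ (j : ℕ),
      ∀ x ∈ (𝔭.DC 𝔟 U).src k y a j, ∀ t ∈ sphere (0:ℂ) ((𝔭.DC 𝔟 U).r k), ∀ (s' : SCube D.toTwoRuns → ℝ) (σ' : SCube D.toTwoRuns → ℂ),
        OnContour (𝔭.DC 𝔟 U).κ₁ ((𝔭.DC 𝔟 U).cubes k y a b) s' σ' → ∀ τ ∈ ball (0:ℂ) (1 / (2 * (cdir * ℓg k j))),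
          ‖(𝔭.DC 𝔟 U).cur k g y a b x t s' σ' τ - (𝔭.DC 𝔟 U).cur k g' y a b x t s' σ' τ‖ ≤ clipa * ((𝔭.DC 𝔟 U).R x.1 / 2) * |g k - g' k|)
    (hroom : ∀ U, ∀ g ∈ W, ∀ (k : ℕ) (y : ι), ∀ a ∈ (𝔭.DC 𝔟 U).S0 k y, ∀ b ∈ (𝔭.DC 𝔟 U).SY k y a, ∀ (j : ℕ), ∀ x ∈ (𝔭.DC 𝔟 U).src k y a j,
      ∀ t ∈ sphere (0:ℂ) ((𝔭.DC 𝔟 U).r k), ∀ (s' : SCube D.toTwoRuns → ℝ) (σ' : SCube D.toTwoRuns → ℂ), OnContour (𝔭.DC 𝔟 U).κ₁ ((𝔭.DC 𝔟 U).cubes k y a b) s' σ' →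
        ∀ τ ∈ ball (0:ℂ) (1 / (2 * (cdir * ℓg k j))), ‖(𝔭.DC 𝔟 U).cur k g y a b x t s' σ' τ‖ ≤ (𝔭.DC 𝔟 U).R x.1 / 2)
    -- species (b): the analytic ∕ geometric clauses of `KerData.Admissible` at the data of record, and the letters
    (hzero : ∀ U k s y a b x t s' σ' p q, 𝔭.ker U k s y a b x t s' σ' p q (0 : TowerData (D.F.P (D.K + 1)) o → ℂ) = 0)
    (hkerB : ∀ (U : D.carriers.BgB) (k : ℕ) (s : ℕ → ℝ) (y : ι), ∀ a ∈ boxes D.toTwoRuns k (𝔭.Yout k y), ∀ b ∈ famC D.toTwoRuns 𝔟 k (𝔭.Yout k y) a, ∀ (j : ℕ),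
      ∀ x ∈ srcC D.toTwoRuns 𝔟 k a j, ∀ t ∈ sphere (0:ℂ) (𝔭.rT k), ∀ (s' : SCube D.toTwoRuns → ℝ) (σ' : SCube D.toTwoRuns → ℂ),
        OnContour 𝔭.κ₁ (cubesListC D.toTwoRuns 𝔟 k a b) s' σ' → ∀ p ∈ 𝔭.pts k y a, ∀ q ∈ 𝔭.pts k y a, ∀ (F : TowerData (D.F.P (D.K + 1)) o → ℂ) (M : ℝ),
          DifferentiableOn ℂ F (ball 0 (𝔭.Rad x.1)) → (∀ z ∈ ball (0 : TowerData (D.F.P (D.K + 1)) o) (𝔭.Rad x.1), ‖F z‖ ≤ M) →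
            ‖𝔭.ker U k s y a b x t s' σ' p q F‖ ≤
              cK * M * gain k j * 𝔭.ρd p q ^ 𝔭.m * Real.exp (-(δ₀ * (𝔭.dX x.1 p + 𝔭.dX x.1 q))))
    (hgeom : ∀ (k : ℕ) (y : ι) (a : SCube D.toTwoRuns) (x : (doubleCarriers D.carriers).Dom), ∀ p ∈ 𝔭.pts k y a, ∀ q ∈ 𝔭.pts k y a,
      δ₁ * 𝔭.ρd (𝔭.p0 x.1) p + δ₁ * 𝔭.ρd p q ≤ δ₀ * (𝔭.dX x.1 p + 𝔭.dX x.1 q) + w * D.carriers.d x.1 + w0)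
    (hsum0 : ∀ (k : ℕ) (y : ι) (a : SCube D.toTwoRuns) (X : D.carriers.Dom), ∑ p ∈ 𝔭.pts k y a, Real.exp (-(δ₁ * 𝔭.ρd (𝔭.p0 X) p)) ≤ c0)
    (hsum1 : ∀ (k : ℕ) (y : ι) (a : SCube D.toTwoRuns), ∀ p ∈ 𝔭.pts k y a,
      ∑ q ∈ 𝔭.pts k y a, 𝔭.ρd p q ^ 𝔭.m * Real.exp (-(δ₁ * 𝔭.ρd p q)) ≤ c1)
    (hcK : 0 ≤ cK) (hgain : ∀ k j, 0 ≤ gain k j) (hρd : ∀ p q, 0 ≤ 𝔭.ρd p q) (hc0 : 0 ≤ c0) (hc1 : 0 ≤ c1)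
    (hκw : 144 ≤ κ - w) (hLbℓ : ∀ k j, j ≤ k → (𝔟.nW : ℝ) * ((D.F.L : ℝ) ^ 4) ^ (k - j) * gain k j ≤ cQb * agePow ω k j)
    (hAb : ∀ U, PieceAdditiveOn (analyticClass (𝔭.KC 𝔟 U).R) (𝔭.KC 𝔟 U).toC) (hlam : 0 ≤ lam)
    (hkerC : ∀ U, ∀ (k : ℕ) (s : ℕ → ℝ) (y : ι) (a : SCube D.toTwoRuns) (b : Finset (SCube D.toTwoRuns)) (x : (doubleCarriers D.carriers).Dom),
      ∀ p ∈ (𝔭.KC 𝔟 U).pts k y a, ∀ q ∈ (𝔭.KC 𝔟 U).pts k y a, ∀ F : TowerData (D.F.P (D.K + 1)) o → ℂ, DifferentiableOn ℂ F (ball 0 ((𝔭.KC 𝔟 U).R x.1)) →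
        Continuous fun wv : ℂ × (SCube D.toTwoRuns → ℝ) × (SCube D.toTwoRuns → ℂ) => (𝔭.KC 𝔟 U).ker k s y a b x wv.1 wv.2.1 wv.2.2 p q F)
    (hkerL : ∀ U, ∀ g ∈ W, ∀ g' ∈ W, ∀ (k : ℕ) (y : ι), ∀ a ∈ (𝔭.KC 𝔟 U).S0 k y, ∀ b ∈ (𝔭.KC 𝔟 U).SY k y a, ∀ (j : ℕ),
      ∀ x ∈ (𝔭.KC 𝔟 U).src k y a j, ∀ t ∈ sphere (0:ℂ) ((𝔭.KC 𝔟 U).r k), ∀ (s' : SCube D.toTwoRuns → ℝ) (σ' : SCube D.toTwoRuns → ℂ),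
        OnContour (𝔭.KC 𝔟 U).κ₁ ((𝔭.KC 𝔟 U).cubes k y a b) s' σ' → ∀ p ∈ (𝔭.KC 𝔟 U).pts k y a, ∀ q ∈ (𝔭.KC 𝔟 U).pts k y a,
          ∀ (F : TowerData (D.F.P (D.K + 1)) o → ℂ) (M : ℝ), DifferentiableOn ℂ F (ball 0 ((𝔭.KC 𝔟 U).R x.1)) → (∀ z ∈ ball (0 : TowerData (D.F.P (D.K + 1)) o) ((𝔭.KC 𝔟 U).R x.1), ‖F z‖ ≤ M) →
            ‖(𝔭.KC 𝔟 U).ker k g y a b x t s' σ' p q F - (𝔭.KC 𝔟 U).ker k g' y a b x t s' σ' p q F‖ ≤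
              cK * lam * M * gain k j * (𝔭.KC 𝔟 U).ρd p q ^ (𝔭.KC 𝔟 U).m * Real.exp (-(δ₀ * ((𝔭.KC 𝔟 U).dX x.1 p + (𝔭.KC 𝔟 U).dX x.1 q))) *
                |g k - g' k|)
    (hcQa : 0 ≤ cQa) (hcQb : 0 ≤ cQb) (hMF : ∀ U, MF U ⊆ analyticClass (𝔭.DC 𝔟 U).R)
    -- the recursion data, per chart
    (U₀ : D.carriers.BgB → TowerData (D.F.P (D.K + 1)) o)
    (explZ : D.carriers.BgB → ℕ → TowerData (D.F.P (D.K + 1)) o → (doubleCarriers D.carriers).Dom → ℝ)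
    (base : D.carriers.BgB → TowerData (D.F.P (D.K + 1)) o → (doubleCarriers D.carriers).Dom → ℝ)
    (hAdm : ∀ U, AdmissibleTerms (EfOf (GoR D) (actOR D ιR cR aR sR P 𝒵 dom Jc VR mI L dk gc pQ pR ρ cc wR U) (weightOf (𝔭.DC 𝔟 U).toC.frame (𝔭.DC 𝔟 U).κ₁ (1 + 𝔟.nA + 𝔟.nB) (2 * (2 ^ 20 + 1)) ((𝔭.DC 𝔟 U).Kp cdir + (𝔭.KC 𝔟 U).Kp cK w0 c0 c1))
      (U₀ U) (explZ U) (base U) (cpieceChannel (𝔭.DC 𝔟 U).toC + cpieceChannel (𝔭.KC 𝔟 U).toC) (margProj (r U) (A U))) W (Adm U))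
    (hres : ∀ U, AdmRestrict (Adm U))
    (hrA : ∀ U, ReadAdditive (Adm U) (r U)) (hr0 : ∀ U, ReadZero (r U)) (hrs : ∀ U, ReadSize (Adm U) (r U) κ cr)
    (hA : ∀ U, DirSize (A U) κ aA) (hcr : 0 ≤ cr) (haA : 0 ≤ aA) (hPinto : ∀ U, ProjInto (Adm U) (MF U) (margProj (r U) (A U)))
    (hclip0 : ∀ k, 0 ≤ clip k)
    (hCup : ∀ U, ∀ g ∈ W, ∀ g' ∈ W, ∀ (k : ℕ) (Vc : TowerData (D.F.P (D.K + 1)) o) (X : (doubleCarriers D.carriers).Dom), (doubleCarriers D.carriers).scale X = k + 1 →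
      ∀ Q ∈ admOf (GoR D) (actOR D ιR cR aR sR P 𝒵 dom Jc VR mI L dk gc pQ pR ρ cc wR U) (weightOf (𝔭.DC 𝔟 U).toC.frame (𝔭.DC 𝔟 U).κ₁ (1 + 𝔟.nA + 𝔟.nB) (2 * (2 ^ 20 + 1)) ((𝔭.DC 𝔟 U).Kp cdir + (𝔭.KC 𝔟 U).Kp cK w0 c0 c1)) (U₀ U) (explZ U)
        (base U) (cpieceChannel (𝔭.DC 𝔟 U).toC + cpieceChannel (𝔭.KC 𝔟 U).toC) (margProj (r U) (A U)) W
        (fun k => sizeRadius (fun k j => (1 + cr * aA) * (tauOfG cQa (agePow ω) + tauOfG cQb (agePow ω)) k j) N k) k,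
      ∀ γ' ∈ (GoR D).vol X,
        ‖actOR D ιR cR aR sR P 𝒵 dom Jc VR mI L dk gc pQ pR ρ cc wR U k (g k) Vc Q γ'‖ ≤ n U k (g' k) Vc γ' ∧
          ‖actOR D ιR cR aR sR P 𝒵 dom Jc VR mI L dk gc pQ pR ρ cc wR U k (g k) Vc Q γ' -
              actOR D ιR cR aR sR P 𝒵 dom Jc VR mI L dk gc pQ pR ρ cc wR U k (g' k) Vc Q γ'‖ ≤ clip k * |g k - g' k| * n U k (g' k) Vc γ')
    (hclipb : ∀ k, clip k ≤ clipbar) (hNb : ∀ j, N j ≤ Nbar)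
    (hqTb : (64 * clipa * cQa + lam * cQb) * ((1 + cr * aA) * Nbar) * (1 - ω)⁻¹ ≤ qTbar)
    (hKP : ∀ U, TwoPointKP (GoR D) W (actOR D ιR cR aR sR P 𝒵 dom Jc VR mI L dk gc pQ pR ρ cc wR U) (admOf (GoR D) (actOR D ιR cR aR sR P 𝒵 dom Jc VR mI L dk gc pQ pR ρ cc wR U) (weightOf (𝔭.DC 𝔟 U).toC.frame (𝔭.DC 𝔟 U).κ₁ (1 + 𝔟.nA + 𝔟.nB) (2 * (2 ^ 20 + 1)) ((𝔭.DC 𝔟 U).Kp cdir + (𝔭.KC 𝔟 U).Kp cK w0 c0 c1))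
      (U₀ U) (explZ U) (base U) (cpieceChannel (𝔭.DC 𝔟 U).toC + cpieceChannel (𝔭.KC 𝔟 U).toC) (margProj (r U) (A U)) W
      (fun k => sizeRadius (fun k j => (1 + cr * aA) * (tauOfG cQa (agePow ω) + tauOfG cQb (agePow ω)) k j) N k)) (n U) lip
      ((dblChart (cubeChart D.toTwoRuns)).supported.sizeWeight a₁) ((dblChart (cubeChart D.toTwoRuns)).supported.sizeWeight d₁))
    (hexplZ : ∀ U, ∀ (k : ℕ) (Vc : TowerData (D.F.P (D.K + 1)) o) (X : (doubleCarriers D.carriers).Dom), (doubleCarriers D.carriers).scale X = k + 1 →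
      |explZ U k Vc X| ≤ Real.exp (-(κ * (doubleCarriers D.carriers).d X)) * p₀ k)
    (hbase0 : ∀ U, ∀ (Vc : TowerData (D.F.P (D.K + 1)) o) (X : (doubleCarriers D.carriers).Dom), (doubleCarriers D.carriers).scale X = 0 →
      |base U Vc X| ≤ Real.exp (-(κ * (doubleCarriers D.carriers).d X)) * N 0)
    (hNsucc : ∀ j, p₀ j + 2 * a₁ ≤ N (j + 1)) (hNnn : ∀ j, 0 ≤ N j)
    (hlipb : ∀ k, lip k ≤ lipbar) (hω : 0 ≤ ω) (hω1 : ω < 1)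
    (hpos : 0 < ω + 8 * lipbar * a₁ * ((1 + cr * aA) * (cQa + cQb))) :
    TermSize (EreOf (GoR D) (actOR D ιR cR aR sR P 𝒵 dom Jc VR mI L dk gc pQ pR ρ cc wR) (fun U => weightOf (𝔭.DC 𝔟 U).toC.frame (𝔭.DC 𝔟 U).κ₁ (1 + 𝔟.nA + 𝔟.nB) (2 * (2 ^ 20 + 1)) ((𝔭.DC 𝔟 U).Kp cdir + (𝔭.KC 𝔟 U).Kp cK w0 c0 c1)) U₀ explZ base
        (fun U => cpieceChannel (𝔭.DC 𝔟 U).toC + cpieceChannel (𝔭.KC 𝔟 U).toC) (fun U => margProj (r U) (A U)) pt) W κ N ∧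
      NE9 (EreOf (GoR D) (actOR D ιR cR aR sR P 𝒵 dom Jc VR mI L dk gc pQ pR ρ cc wR) (fun U => weightOf (𝔭.DC 𝔟 U).toC.frame (𝔭.DC 𝔟 U).κ₁ (1 + 𝔟.nA + 𝔟.nB) (2 * (2 ^ 20 + 1)) ((𝔭.DC 𝔟 U).Kp cdir + (𝔭.KC 𝔟 U).Kp cK w0 c0 c1)) U₀ explZ base
        (fun U => cpieceChannel (𝔭.DC 𝔟 U).toC + cpieceChannel (𝔭.KC 𝔟 U).toC) (fun U => margProj (r U) (A U)) pt) W κ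
        (prodModuli (8 * clipbar * a₁ + 8 * lipbar * a₁ * qTbar) fun _ => ω + 8 * lipbar * a₁ * ((1 + cr * aA) * (cQa + cQb))) ∧
        FadingMemory ((8 * clipbar * a₁ + 8 * lipbar * a₁ * qTbar) / (ω + 8 * lipbar * a₁ * ((1 + cr * aA) * (cQa + cQb))))
          (ω + 8 * lipbar * a₁ * ((1 + cr * aA) * (cQa + cQb)))
          (prodModuli (8 * clipbar * a₁ + 8 * lipbar * a₁ * qTbar)
            fun _ => ω + 8 * lipbar * a₁ * ((1 + cr * aA) * (cQa + cQb))) :=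
  termSize_ne9_and_fadingMemory_ofConvAct D 𝔟 ιR cR aR sR P 𝒵 dom Jc VR mI L dk gc pQ pR ρ cc wR U₁ pt 𝔭 ℓk hκ₁1 hrT hRad
    hcur hϱgt hϱinv hℓ hκ hκ₁ hnA hLaℓ hAa hclipa hcdir hhalf hcont hlip hroom hzero hkerB hgeom hsum0 hsum1 hcK hgain hρd hc0 hc1 hκw hLbℓ hAb
    hlam hkerC hkerL hcQa hcQb hMF U₀ explZ base hAdm hres hrA hr0 hrs hA hcr haA hPinto hclip0 hCup hclipb hNb hqTb hKP
    (decayExtract_dbl (cubeChart D.toTwoRuns) (le_trans (le_trans (by norm_num) hκ) hκd))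
    (pinBudget_dbl (cubeChart D.toTwoRuns) ha₁ (le_trans (by norm_num) hκ) hκd)
    hexplZ hbase0 hNsucc hNnn ha₁ hlipb hω hω1 hpos

end Summit.QuantumFields.BalabanUV.T4Continuum.NE9EndOfRecordActConvention

end
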